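import Literature.NumberTheory.Automorphic.Liu2021.LemD1Item3AtVNonsplitOfLineTransport
import Summits.HodgeConjecture.CorCM.B01.Transposition.Item6OmegaChiSplitting
import Summits.HodgeConjecture.HodgeCM.CM.Basic
import Summits.HodgeConjecture.HodgeCM.Model.ArchSideTerm
import Literature.NumberTheory.Automorphic.IdeleClassCharacterHecke
import Literature.RepresentationTheory.Liu2021.OscillatorConventions
import Literature.NumberTheory.GelbartRogawski1991.CMSplittingCharLocalMu
import HarnessLib

/-!
# `hD3` line `a4-liuD3`, stub (:185) `stub_sameClass_and_chi_of_iso_nonsplit : SameClassChiOfIsoNonsplit` — CLOSED MODULO row IV-4c1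
# (cell `hodgecm-mathlib`, binder `HypD3` = [Liu2021, App. D Lem. D.1 (3)] AS PRINTED per finite place; crux item stmt-HodgeConjecture-24837)

Summits side, binder subdirectory `CorCM/HypD3/`.  The crux skeleton `A-plan/lines/a4-liuD3.lean` (v1 sha16 5422b04d6cb4d0fa, REF1 PASS
2026-08-28T02:57:41Z; v2 = `e ↦ e₁` + (D1) fact threading, RULINGS 02:54:52Z / 02:58:23Z; namespace
`Summit.HodgeConjecture.CorCM.Lines.A4LiuD3`) cuts `hD3` into five stubs over the family of record
`famAtV F e₁ dV hdV hdV0 ψ hψ aOf χOf v := Def411WeilCarriers.localIndexedFamilyAtV F⁺ F c 3 e₁ (diagonal dV) … v` (`F⁺ = maximalRealSubfield F`,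
`c = complexConj`, ONE trace-zero `δ = imagUnit F`, `e₁ = Equiv.prodUnique (Fin 3) (Fin 1)`, member `t ↦ (a_t, χ_t, χ-splitting of μ_t, localMu μ_t)`).
Its stub (:185) is the `(ε, χ)`-third of (3), «⇒» direction, at a place `v` of `F⁺` NON-SPLIT in `F` (`IsField (F ⊗ F⁺_v)`): if
`ω(μ_j, ε_j, χ_j) ≅ ω(μ_i, ε_i, χ_i)` (`AreIsomorphicRep (quot j) (quot i)`) then `ε_i`, `ε_j` lie in ONE class of `E_v^{−×}/Nm E_vˣ`
(`LemD1.SameClass (eps i) (eps j)`) and `χ_j = χ_i` (`chi j = chi i`), CONDITIONAL on the named fact IV-4c1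
`rankOne_theta_lines_disjoint` ([GelbartRogawski1990, Prop. 5.1.4] / theta dichotomy; D-0014) — in v2 the fact is the stub's LEADING HYPOTHESIS.

This file PROVES that statement (with `famAtV` replaced by its definiens, character-identical to the skeleton's :102 at `e := e₁`; the v2 stub
closes by `exact Summit.HodgeConjecture.CorCM.HypD3.sameClassChiOfIsoNonsplit`).  PROOF = the Literature theorem
`Def411WeilCarriers.sameClass_and_chi_eq_of_areIsomorphicRep_nonsplit_prodUnique` (A-p05, `Liu2021/LemD1Item3AtVNonsplitOfLineTransport.lean`, itself
`sameClass_and_chi_eq_of_areIsomorphicRep_nonsplit_of_modelTransport` of `Liu2021/LemD1Item3AtVOfSeparation.lean`: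
the transport chain `quot t ≅ Θ_{s_t}(χ_{t,v}) ∘ uEquiv`, MVW IV.2 non-vanishing PROVED at the isotropic rank-3 space, B-p13's separation
`rankOne_theta_epsClass_and_char_eq_of_areIsomorphicRep` mod IV-4c1) instantiated at the `e′_a` LINE-MODEL TRANSPORT of B-p13
(`GelbartRogawski1991/LocalLineModelTransport.lean`: `lineTransportSection`, `proj_/omega_/isSmooth_lineTransportSection`,
`epsLine_eq_mul_conj_mul_eps_lineDelta`; `δ'_t = a_t⁻¹ δ`, `M_t = 1`).  No new fact, no definition, debt Δ 0.

HC_CM is proved only modulo the 7 printed citations (`hDel`, `h21`, `hLiu418`, `h411`, `h413`, `hD3`, `hD1''`) until rung 0 closes; this file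
discharges no binder by itself (it closes one of five stubs of the `hD3` line, modulo IV-4c1).

## References
* [Liu2021] Y. Liu, Camb. J. Math. 9 (2021) = arXiv:2102.11518, App. D Lemma D.1 (3) (l. 5233), proof l. 5255.
* [GelbartRogawski1990] S. Gelbart, J. Rogawski, PS-Festschrift I (1990), Prop. 5.1.4.
* [MoeglinVignerasWaldspurger1987] C. Mœglin, M.-F. Vignéras, J.-L. Waldspurger, LNM 1291, Chap. 2 II.1, Chap. 3 IV.2, IV.4.
-/

set_option autoImplicit false

noncomputable section

namespace Summit.HodgeConjecture.CorCM.HypD3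
open scoped TensorProduct Matrix
open NumberField NumberField.InfinitePlace
open Literature.NumberTheory.ComplexMultiplication
open Literature.NumberTheory.Automorphic
open Literature.NumberTheory.Automorphic.IdeleClassGroup (toHeckeCharacter isUnitary_toHeckeCharacter)
open Literature.NumberTheory.Automorphic.Liu2021
open HodgeCM.Model.ArchSideTerm (e₁)
open Literature.NumberTheory.GelbartRogawski1991 Literature.NumberTheory.GelbartRogawski1991.UnitaryDualPair
open Literature.NumberTheory.GelbartRogawski1991.UnitaryDualPair.LocalSplitting (localMu norm_localMu continuous_localMu localMu_toLocalRing_eq_one_iff)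
open Literature.RepresentationTheory Literature.RepresentationTheory.Liu2021
open Literature.RepresentationTheory.MoeglinVignerasWaldspurger1987 (rankOne_theta_lines_disjoint)
open Summit.HodgeConjecture.CorCM.Transposition

/-- **Line `a4-liuD3`, stub (:185) `SameClassChiOfIsoNonsplit`, PROVED MODULO row IV-4c1** — at a place `v` of `F⁺` NON-SPLIT in `F`,
for every CM field `F` (as `HodgeCM.CMField`), real frame `dV` (`c dV_i = dV_i ≠ 0`), index maps `ψ, hψ, aOf, χOf` and members `i, j` of the
family of record at `e₁`: `ω(μ_j, ε_j, χ_j) ≅ ω(μ_i, ε_i, χ_i)` («isomorphic», READING L7) ⟹ `LemD1.SameClass (ε_i) (ε_j)` AND `χ_j = χ_i` — the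
`ε`- and `χ`-summands of [Liu2021, Lem. D.1 (3)] AS PRINTED (`LemD1_3AsPrintedI`), under the hypothesis `rankOne_theta_lines_disjoint`
(row IV-4c1, the stub's leading binder in v2).  Statement = the body of `Summit.HodgeConjecture.CorCM.Lines.A4LiuD3.SameClassChiOfIsoNonsplit`
(a4-liuD3.lean :109, v2 shape: fact first, `e := e₁`) with `famAtV` unfolded to its definiens (:102).  Proof: the Literature theorem
`sameClass_and_chi_eq_of_areIsomorphicRep_nonsplit_prodUnique` (the transport chain at B-p13's `e′_a` transport: `lineTransportSection`,
`δ'_t = a_t⁻¹ δ`, `M_t = 1`) at the `hD3` datum `F⁺ ⊂ F`, `c`, `δ = imagUnit F`, `T_V = realDiagonal dV`, `e₁ = Equiv.prodUnique`. [cite: Liu2021, App. D Lemma D.1 (3) (l. 5233), proof l. 5255 (= GelbartRogawski1990 Prop. 5.1.4, n = 3)]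
[cite: MoeglinVignerasWaldspurger1987, Chap. 3 IV.2, IV.4] -/
theorem sameClassChiOfIsoNonsplit (h41 : rankOne_theta_lines_disjoint) :
    ∀ (F : HodgeCM.CMField) (dV : Fin 3 → (F : Type))
      (hdV : ∀ i, IsCMField.complexConj (F : Type) (dV i) = dV i) (hdV0 : ∀ i, dV i ≠ 0) {ι : Type}
      (ψ : ι → (Literature.NumberTheory.Automorphic.IdeleClassGroup (F : Type) →ₜ* Circle))
      (hψ : ∀ t, IdeleClassGroup.IsConjugateSymplectic (F : Type) (ψ t))
      (aOf : ι → (↥(maximalRealSubfield (F : Type)))ˣ)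
      (χOf : ι → Def411WeilCarriers.Chi ↥(maximalRealSubfield (F : Type)) (F : Type) (IsCMField.complexConj (F : Type)))
      (v : IsDedekindDomain.HeightOneSpectrum (𝓞 ↥(maximalRealSubfield (F : Type)))),
      IsField (UnitaryGroup.LocalRing (F : Type) v) →
      ∀ i j : ι,
        AreIsomorphicRep
          ((Def411WeilCarriers.localIndexedFamilyAtV (ι := ι) ↥(maximalRealSubfield (F : Type)) (F : Type) (IsCMField.complexConj (F : Type)) 3 e₁ (Matrix.diagonal dV) (complexConj_imagUnit (F : Type)) (imagUnit_ne_zero (F : Type)) (imagUnit_mul_self (F : Type)) (realDiagonal_isSymm (F : Type) dV hdV) (isUnit_det_realDiagonal (F : Type) dV hdV hdV0) (realDiagonal_map (F : Type) dV hdV).symm (le_refl 3) aOf χOf (fun t => OmegaChiSplitting.chiLocalSplittingsD ⟨HodgeCM.CMField.K F⟩ e₁ dV hdV hdV0 (toHeckeCharacter (F : Type) (ψ t)) ((isOscillatorChar_toHeckeCharacter_iff (ψ t)).mpr (hψ t)) (aOf t)) (fun t => localMu (F : Type) (toHeckeCharacter (F : Type) (ψ t))) (fun t v x => norm_localMu (F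 : Type) (toHeckeCharacter (F : Type) (ψ t)) v (isUnitary_toHeckeCharacter (F : Type) (ψ t)) x) (fun t => continuous_localMu (F : Type) (toHeckeCharacter (F : Type) (ψ t))) (fun t v x => localMu_toLocalRing_eq_one_iff (F : Type) (toHeckeCharacter (F : Type) (ψ t)) v ((isOscillatorChar_toHeckeCharacter_iff (ψ t)).mpr (hψ t)) x) v).quot j)
          ((Def411WeilCarriers.localIndexedFamilyAtV (ι := ι) ↥(maximalRealSubfield (F : Type)) (F : Type) (IsCMField.complexConj (F : Type)) 3 e₁ (Matrix.diagonal dV) (complexConj_imagUnit (F : Type)) (imagUnit_ne_zero (F : Type)) (imagUnit_mul_self (F : Type)) (realDiagonal_isSymm (F : Type) dV hdV) (isUnit_det_realDiagonal (F : Type) dV hdV hdV0) (realDiagonal_map (F : Type) dV hdV).symm (le_refl 3) aOf χOf (fun t => OmegaChiSplitting.chiLocalSplittingsD ⟨HodgeCM.CMField.K F⟩ e₁ dV hdV hdV0 (toHeckeCharacter (F : Type) (ψ t)) ((isOscillatorChar_toHeckeCharacter_iff (ψ t)).mpr (hψ t)) (aOf t)) (fun t => localMu (F : Type) (toHeckeCharacter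 (F : Type) (ψ t))) (fun t v x => norm_localMu (F : Type) (toHeckeCharacter (F : Type) (ψ t)) v (isUnitary_toHeckeCharacter (F : Type) (ψ t)) x) (fun t => continuous_localMu (F : Type) (toHeckeCharacter (F : Type) (ψ t))) (fun t v x => localMu_toLocalRing_eq_one_iff (F : Type) (toHeckeCharacter (F : Type) (ψ t)) v ((isOscillatorChar_toHeckeCharacter_iff (ψ t)).mpr (hψ t)) x) v).quot i) →
        LemD1.SameClass
            ((Def411WeilCarriers.localIndexedFamilyAtV (ι := ι) ↥(maximalRealSubfield (F : Type)) (F : Type) (IsCMField.complexConj (F : Type)) 3 e₁ (Matrix.diagonal dV) (complexConj_imagUnit (F : Type)) (imagUnit_ne_zero (F : Type)) (imagUnit_mul_self (F : Type)) (realDiagonal_isSymm (F : Type) dV hdV) (isUnit_det_realDiagonal (F : Type) dV hdV hdV0) (realDiagonal_map (F : Type) dV hdV).symm (le_refl 3) aOf χOf (fun t => OmegaChiSplitting.chiLocalSplittingsD ⟨HodgeCM.CMField.K F⟩ e₁ dV hdV hdV0 (toHeckeCharacter (F : Type) (ψ t)) ((isOscillatorChar_toHeckeCharacter_iff (ψ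 t)).mpr (hψ t)) (aOf t)) (fun t => localMu (F : Type) (toHeckeCharacter (F : Type) (ψ t))) (fun t v x => norm_localMu (F : Type) (toHeckeCharacter (F : Type) (ψ t)) v (isUnitary_toHeckeCharacter (F : Type) (ψ t)) x) (fun t => continuous_localMu (F : Type) (toHeckeCharacter (F : Type) (ψ t))) (fun t v x => localMu_toLocalRing_eq_one_iff (F : Type) (toHeckeCharacter (F : Type) (ψ t)) v ((isOscillatorChar_toHeckeCharacter_iff (ψ t)).mpr (hψ t)) x) v).eps i)
            ((Def411WeilCarriers.localIndexedFamilyAtV (ι := ι) ↥(maximalRealSubfield (F : Type)) (F : Type) (IsCMField.complexConj (F : Type)) 3 e₁ (Matrix.diagonal dV) (complexConj_imagUnit (F : Type)) (imagUnit_ne_zero (F : Type)) (imagUnit_mul_self (F : Type)) (realDiagonal_isSymm (F : Type) dV hdV) (isUnit_det_realDiagonal (F : Type) dV hdV hdV0) (realDiagonal_map (F : Type) dV hdV).symm (le_refl 3) aOf χOf (fun t => OmegaChiSplitting.chiLocalSplittingsD ⟨HodgeCM.CMField.K F⟩ e₁ dV hdV hdV0 (toHeckeCharacter (F : Type) (ψ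 t)) ((isOscillatorChar_toHeckeCharacter_iff (ψ t)).mpr (hψ t)) (aOf t)) (fun t => localMu (F : Type) (toHeckeCharacter (F : Type) (ψ t))) (fun t v x => norm_localMu (F : Type) (toHeckeCharacter (F : Type) (ψ t)) v (isUnitary_toHeckeCharacter (F : Type) (ψ t)) x) (fun t => continuous_localMu (F : Type) (toHeckeCharacter (F : Type) (ψ t))) (fun t v x => localMu_toLocalRing_eq_one_iff (F : Type) (toHeckeCharacter (F : Type) (ψ t)) v ((isOscillatorChar_toHeckeCharacter_iff (ψ t)).mpr (hψ t)) x) v).eps j) ∧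
          (Def411WeilCarriers.localIndexedFamilyAtV (ι := ι) ↥(maximalRealSubfield (F : Type)) (F : Type) (IsCMField.complexConj (F : Type)) 3 e₁ (Matrix.diagonal dV) (complexConj_imagUnit (F : Type)) (imagUnit_ne_zero (F : Type)) (imagUnit_mul_self (F : Type)) (realDiagonal_isSymm (F : Type) dV hdV) (isUnit_det_realDiagonal (F : Type) dV hdV hdV0) (realDiagonal_map (F : Type) dV hdV).symm (le_refl 3) aOf χOf (fun t => OmegaChiSplitting.chiLocalSplittingsD ⟨HodgeCM.CMField.K F⟩ e₁ dV hdV hdV0 (toHeckeCharacter (F : Type) (ψ t)) ((isOscillatorChar_toHeckeCharacter_iff (ψ t)).mpr (hψ t)) (aOf t)) (fun t => localMu (F : Type) (toHeckeCharacter (F : Type) (ψ t))) (fun t v x => norm_localMu (F : Type) (toHeckeCharacter (F : Type) (ψ t)) v (isUnitary_toHeckeCharacter (F : Type) (ψ t)) x) (fun t => continuous_localMu (F : Type) (toHeckeCharacter (F : Type) (ψ t))) (fun t v x => localMu_toLocalRing_eq_one_iff (F : Type) (toHeckeCharacter (F : Type) (ψ t)) v ((isOscillatorChar_toHeckeCharacter_iff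 (ψ t)).mpr (hψ t)) x) v).chi j =
          (Def411WeilCarriers.localIndexedFamilyAtV (ι := ι) ↥(maximalRealSubfield (F : Type)) (F : Type) (IsCMField.complexConj (F : Type)) 3 e₁ (Matrix.diagonal dV) (complexConj_imagUnit (F : Type)) (imagUnit_ne_zero (F : Type)) (imagUnit_mul_self (F : Type)) (realDiagonal_isSymm (F : Type) dV hdV) (isUnit_det_realDiagonal (F : Type) dV hdV hdV0) (realDiagonal_map (F : Type) dV hdV).symm (le_refl 3) aOf χOf (fun t => OmegaChiSplitting.chiLocalSplittingsD ⟨HodgeCM.CMField.K F⟩ e₁ dV hdV hdV0 (toHeckeCharacter (F : Type) (ψ t)) ((isOscillatorChar_toHeckeCharacter_iff (ψ t)).mpr (hψ t)) (aOf t)) (fun t => localMu (F : Type) (toHeckeCharacter (F : Type) (ψ t))) (fun t v x => norm_localMu (F : Type) (toHeckeCharacter (F : Type) (ψ t)) v (isUnitary_toHeckeCharacter (F : Type) (ψ t)) x) (fun t => continuous_localMu (F : Type) (toHeckeCharacter (F : Type) (ψ t))) (fun t v x => localMu_toLocalRing_eq_one_iff (F : Type) (toHeckeCharacter (F : Type)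 (ψ t)) v ((isOscillatorChar_toHeckeCharacter_iff (ψ t)).mpr (hψ t)) x) v).chi i := by
  intro F dV hdV hdV0 ι ψ hψ aOf χOf v hE i j hiso
  exact Def411WeilCarriers.sameClass_and_chi_eq_of_areIsomorphicRep_nonsplit_prodUnique ↥(maximalRealSubfield (F : Type)) (F : Type)
    (IsCMField.complexConj (F : Type)) (Matrix.diagonal dV) (complexConj_imagUnit (F : Type)) (imagUnit_ne_zero (F : Type))
    (imagUnit_mul_self (F : Type)) h41 (realDiagonal_isSymm (F : Type) dV hdV) (isUnit_det_realDiagonal (F : Type) dV hdV hdV0)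
    (realDiagonal_map (F : Type) dV hdV).symm aOf χOf
    (fun t => OmegaChiSplitting.chiLocalSplittingsD ⟨HodgeCM.CMField.K F⟩ e₁ dV hdV hdV0 (toHeckeCharacter (F : Type) (ψ t))
      ((isOscillatorChar_toHeckeCharacter_iff (ψ t)).mpr (hψ t)) (aOf t))
    (fun t => localMu (F : Type) (toHeckeCharacter (F : Type) (ψ t)))
    (fun t v x => norm_localMu (F : Type) (toHeckeCharacter (F : Type) (ψ t)) v (isUnitary_toHeckeCharacter (F : Type) (ψ t)) x)
    (fun t => continuous_localMu (F : Type) (toHeckeCharacter (F : Type) (ψ t)))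
    (fun t v x => localMu_toLocalRing_eq_one_iff (F : Type) (toHeckeCharacter (F : Type) (ψ t)) v
      ((isOscillatorChar_toHeckeCharacter_iff (ψ t)).mpr (hψ t)) x)
    v hE i j hiso

end Summit.HodgeConjecture.CorCM.HypD3

end
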